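/-
Copyright (c) 2026. All rights reserved.
Released under Apache 2.0 license as described in the file LICENSE.
Authors: abc-iut cell, prover seat abc-iut-L4-d2 (gen 9).
-/
import Mathlib.Data.Real.Basic
import Literature.AnabelianGeometry.AbsoluteAnabelian.GaloisTheatersNumberFieldShadowTFPairsCor52iii
import Literature.AnabelianGeometry.AbsoluteAnabelian.GaloisTheatersNumberFieldShadowRmk511
import Literature.AnabelianGeometry.AbsoluteAnabelian.PanalocalTPairs
import HarnessLib

/-!
# [AbsTopIII] Def 5.1 (vi) / Cor 5.2 (vi): essential surjectivity of the panalocalization of `T`-pairs (F-3087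
# `PanalocalTPairEssSurj`) and the node `Cor52vi` (F-3092) REFUTED at the group-only `TF`-shadow vocabulary

S. Mochizuki, *Topics in absolute anabelian geometry III* [MochizukiAbsTopIII2015], Def 5.1 (vi) p. 118 (the panalocalization
functor `Th⊚_T → Th✠_T` "is essentially surjective"), Cor 5.2 (vi) p. 120, Def 3.1 (ii) p. 67 (an MLF-Galois `T`-pair is a pair
ISOMORPHIC TO A MODEL pair).

The cell types "every panalocal `T`-pair is [isomorphic to] the panalocalization of a global one" as the named fact
`PanalocalTPairEssSurj W` (F-3087; `PanalocalTPairs.lean`, abc-iut-L4-t3) over the interface vocabulary `W`, whose predicate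
"`(D ↷ M)` is an MLF-Galois `T`-pair" is a field of `W`.  At the `TF`-shadow vocabulary `fieldShadowVocabulary F` (abc-iut-L4-d2 g7,
p491073) that predicate is the GROUP-THEORETIC half of Def 3.1 (ii) only (`IsMLFGaloisType D`), so a panalocal `TF`-pair with
TRIVIAL actions qualifies — and it is the panalocalization of NO global `TF`-pair: a panalocalization identifies, at a lift `ṽ` of
each nonarchimedean class, the local pair with the local pair `((Π_E)_ṽ ↷ M_ṽ)` of the global pair, which through its reference
isomorphism `ψ_ṽ` (Def 5.1 (v) (b)) is the CHART ACTION of the decomposition group `Π_{E,ṽ}` on `ℚ̄` — non-trivial, since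
`Π_{E,ṽ}` is of MLF type (infinite) and the `ℚ`-chart of an admissible `Π_E` is injective.  THIS PROOF-ONLY FILE records

* `exists_mem_decomp_smul_ne` — at an admissible `Π_E` of the shadow every nonarchimedean decomposition group contains an
  element acting non-trivially on `ℚ̄`;
* **`not_panalocalTPairEssSurj_fieldShadow : ¬ PanalocalTPairEssSurj (fieldShadowVocabulary F)`** (F-3087 REFUTED AS TYPED at
  the group-only predicate) and **`not_cor52vi_fieldShadow : ¬ Cor52vi (fieldShadowVocabulary F)`** (F-3092 there).

HONEST LABEL: refuted-as-typed at ONE instance (the unprimed shadow vocabulary, where Def 3.1 (ii)'s "isomorphic to a model" is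
not read); at the print-shape predicate (`fieldShadowVocabulary' F`, p493095) the same row is EQUIVALENT to a local Galois
rigidity statement (sequel).  Shadow (`Δ = 1`) ≠ the genuine `(R, W)` (E-L4-13); refuted-as-typed ≠ refuted-in-print.  No
`def`/`instance`/`structure`; nothing here bears on [IUTchIII] Cor. 3.12 or takes a side; typed ≠ proved.
-/

noncomputable section

open scoped Pointwise Topology
open CategoryTheory NumberField Field

namespace Literature.AnabelianGeometry.AbsoluteAnabelian

namespace NumberFieldShadow

variable (F : Type) [Field F] [NumberField F]

/-! ### Nonarchimedean decomposition groups act non-trivially on `ℚ̄` -/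

/-- **At an admissible `Π_E` of the shadow, every nonarchimedean decomposition group `Π_{E,ṽ}` contains an element acting
non-trivially on `ℚ̄` through the `ℚ`-chart**: `Π_{E,ṽ}` is of MLF-Galois type, hence infinite (the absolute Galois group of an
MLF is infinite), so it has an element `g ≠ 1`; the chart of an admissible `Π_E` is injective and `G_ℚ` acts faithfully on `ℚ̄`.
[cite: MochizukiAbsTopIII2015, Def 5.1 (iii) p.115] -/
theorem exists_mem_decomp_smul_ne {E : FundamentalExtension.{0}} (hE : IsAdmissible F E)
    (v : (contextProVal E).carrier) (hv : v ∈ (contextProVal E).non) :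
    ∃ (g : E.arith) (_ : g ∈ (contextProVal E).decomp v) (x : AlgebraicClosure ℚ), ratChart E g • x ≠ x := by
  have hMLF := isMLFGaloisType_decomp_context F hE v hv ((contextProVal E).isClosed_decomp v)
  obtain ⟨k, _, _, hk, ⟨e⟩⟩ := hMLF
  haveI := hk.infinite_absoluteGaloisGroup
  haveI : Infinite ((contextProVal E).decomp v) := Infinite.of_injective e.symm e.symm.injective
  obtain ⟨g, hg1⟩ := exists_ne (1 : (contextProVal E).decomp v)
  refine ⟨g.1, g.2, ?_⟩
  by_contra h
  simp only [not_exists, ne_eq, not_not] at h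
  have hchart : ratChart E g.1 = 1 := gal_eq_of_forall_smul_eq fun x => by rw [h x, one_smul]
  exact hg1 (Subtype.ext (ratChart_injective_of_isAdmissible F hE (by rw [hchart, OneMemClass.coe_one, map_one])))

/-! ### F-3087 and F-3092 are FALSE at the group-only `TF`-shadow vocabulary -/

/-- **`PanalocalTPairEssSurj` (F-3087) is FALSE at the `TF`-shadow vocabulary `fieldShadowVocabulary F`** (group-theoretic
MLF-pair predicate): over a panalocalization `V✠` of `V⊚(E_F)`, the panalocal `TF`-pair with local data `ℚ̄`, TRIVIAL actions (it
qualifies: the groups of `V✠` are of MLF type) and transported Kummer embeddings is the panalocalization of no global `TF`-pair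
`M⊚` — at a lift `ṽ` of a nonarchimedean class the panalocalization relation makes the action of `(Π_E)_ṽ` on `M_ṽ` trivial, whereas
reference condition (b) of Def 5.1 (v) identifies it with the chart action of `Π_{E,ṽ}` on `ℚ̄`, which moves some element.
(Refuted-as-typed at an instance; Def 3.1 (ii)'s "isomorphic to a model pair" — the primed vocabulary — excludes the witness.)
[cite: MochizukiAbsTopIII2015, Def 5.1 (vi) p.118] -/
theorem not_panalocalTPairEssSurj_fieldShadow : ¬ PanalocalTPairEssSurj (fieldShadowVocabulary F) := by
  intro h
  -- a panalocalization `V✠` of the theater `V⊚(E_F)`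
  obtain ⟨V, E₀, hE₀, ψ₀, href₀⟩ :
      ∃ (V : PanalocalGaloisTheater (context F)) (E : FundamentalExtension.{0}) (_ : (context F).IsAdmissible E)
        (ψ : (context F).ProValModAut E ≃ V.V), IsPanalocalReferenceFor (context F) V.generic V.non V.arc V.grp V.X E ψ := by
    obtain ⟨V, -⟩ := panalocalizationExists_context F (extension F) (isAdmissible_extension F)
    obtain ⟨E, hE, ψ, hψ⟩ := V.exists_reference
    exact ⟨V, E, hE, ψ, hψ⟩
  obtain ⟨-, -, -, hgrp, hX⟩ := href₀
  -- its groups are of MLF type; its orbispaces carry Kummer embeddings of `ℚ̄`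
  have hMLF : ∀ v : V.non, IsMLFGaloisType (V.grp v) := fun v => by
    obtain ⟨vl, hvl, -, ⟨e⟩⟩ := hgrp v
    exact IsMLFGaloisType.of_continuousMulEquiv (isMLFGaloisType_decomp_context F hE₀ vl hvl _) e
  have hK : ∀ v : V.arc, ∃ κ : AlgebraicClosure ℚ →+* (V.X v).fieldA, Function.Injective κ := fun v => by
    obtain ⟨vl, -, ⟨x⟩⟩ := hX v
    exact ⟨x.fieldIso.symm.toRingHom.comp (contextKappa E₀ vl),
      (x.fieldIso.symm.injective).comp (contextKappa E₀ vl).injective⟩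
  choose κ hκ using hK
  -- the panalocal `TF`-pair with trivial actions
  let Q : PanalocalTPair (fieldShadowVocabulary F) :=
    { theater := V
      data :=
        { Mnon := fun _ => CommRingCat.of (AlgebraicClosure ℚ)
          actNon := fun _ => 1
          isMLF := fun v => hMLF v
          Marc := fun _ => CommRingCat.of (AlgebraicClosure ℚ)
          kummer := fun v => κ v
          isAutHol := fun v => hκ v } }
  -- suppose it is the panalocalization of a global `TF`-pair `M⊚`
  obtain ⟨M, ψV, hψV, ψ, href, hnonC, -⟩ := h Q
  have hE : IsAdmissible F M.theater.ext := M.theater.isAdmissible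
  -- the reference structure of `M⊚` (its `ψ_V` IS the one of the relation, Rmk 5.1.1)
  obtain ⟨ψV', hψV', hnon, harc, ψg, ψnon, ψarc, -, hb, -, -, -⟩ := M.exists_reference
  have hψ : ψV' = ψV := referenceIsoUnique_context F M.theater ψV' ψV hψV' hψV
  subst hψ
  -- a nonarchimedean local element `ṽ` of `Π_E`, `E := M.theater.ext`, and an element of `Π_{E,ṽ}` moving some `x ∈ ℚ̄`
  obtain ⟨A, -, hA, -, -⟩ := exists_valuationSubring_ne_top_ne ℚ
  let vl : (contextProVal M.theater.ext).carrier := Sum.inr (Sum.inl ⟨A, hA⟩)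
  have hvl : vl ∈ (contextProVal M.theater.ext).non := ⟨⟨A, hA⟩, rfl⟩
  obtain ⟨g, hg, x, hgx⟩ := exists_mem_decomp_smul_ne F hE vl hvl
  have hvlV : ψV' vl ∈ M.theater.V.non := hnon ⟨vl, hvl⟩
  have hg' : g ∈ M.theater.V.decomp (ψV' vl) := by
    rw [hψV'.decomp_apply vl]
    exact hg
  -- the relation at `ṽ`: the action of `(Π_E)_ṽ` on `M_ṽ` is intertwined with the TRIVIAL action
  have hc : ψ ((context F).toModAut M.theater.ext vl) ∈ Q.theater.non := href.2.1 vl hvl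
  obtain ⟨e, φ, heφ⟩ := hnonC vl hvlV hc
  have htriv : ∀ m, φ.hom.hom ((M.actNon ⟨ψV' vl, hvlV⟩ ⟨g, hg'⟩).hom.hom m) = φ.hom.hom m := fun m => by
    have h1 := congrArg (fun f : M.Mnon ⟨ψV' vl, hvlV⟩ ⟶ Q.data.Mnon ⟨_, hc⟩ => f.hom m) (heφ ⟨g, hg'⟩)
    change φ.hom.hom ((M.actNon ⟨ψV' vl, hvlV⟩ ⟨g, hg'⟩).hom.hom m) =
      ((1 : Q.theater.grp ⟨_, hc⟩ →* Aut (Q.data.Mnon ⟨_, hc⟩)) (e ⟨g, hg'⟩)).hom.hom (φ.hom.hom m) at h1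
    rw [MonoidHom.one_apply] at h1
    exact h1
  have hinjφ : Function.Injective φ.hom.hom :=
    (φ.commRingCatIsoToRingEquiv : (show CommRingCat.{0} from M.Mnon ⟨ψV' vl, hvlV⟩) ≃+*
      (show CommRingCat.{0} from Q.data.Mnon ⟨_, hc⟩)).injective
  have hact : ∀ m, (M.actNon ⟨ψV' vl, hvlV⟩ ⟨g, hg'⟩).hom.hom m = m := fun m => hinjφ (htriv m)
  -- but through `ψ_ṽ` it is the chart action of `Π_{E,ṽ}` on `ℚ̄` (reference condition (b)), which moves `x`
  apply hgx
  have hψinj : Function.Injective (ψnon ⟨vl, hvl⟩).hom.hom :=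
    ((ψnon ⟨vl, hvl⟩).commRingCatIsoToRingEquiv : (CommRingCat.of (AlgebraicClosure ℚ) : CommRingCat.{0}) ≃+*
      (show CommRingCat.{0} from M.Mnon ⟨ψV' vl, hvlV⟩)).injective
  apply hψinj
  have key := iso_hom_conj (ψnon ⟨vl, hvl⟩) _ _ (hb ⟨vl, hvl⟩ g hg hg') x
  rw [hact] at key
  exact key

/-- **Cor 5.2 (vi) as one node (F-3092 `Cor52vi`) is FALSE at the `TF`-shadow vocabulary `fieldShadowVocabulary F`** — its third
conjunct `PanalocalTPairEssSurj` fails there (`not_panalocalTPairEssSurj_fieldShadow`); the first conjunct HOLDS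
(`panalocalTPairExists_fieldShadow`, sibling file).  Refuted-as-typed at the group-only predicate.
[cite: MochizukiAbsTopIII2015, Cor 5.2 (vi) p.120] -/
theorem not_cor52vi_fieldShadow : ¬ Cor52vi (fieldShadowVocabulary F) :=
  fun h => not_panalocalTPairEssSurj_fieldShadow F h.2.2

end NumberFieldShadow

end Literature.AnabelianGeometry.AbsoluteAnabelian

end
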